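import Summits.QuantumAdvantage.QuantumAdvantage.Theorems.CouplingDialNil

/-!
# CouplingDial (part E, index two) — `N_2 ⟺ T`: index-2 couplings are free (`compL`, `eval_compL`, `strFunC`, `nilRung_two_iff`)

Tree twin of node «CouplingDial» rev 3 §11 (cut verbatim).  An index-2 unipotent coupling is an involution, so `Φ_L(F,G) = Φ_𝟙(F, G ∘ L)`
(`value_compL_of_involutive`); the cubic table of `G ∘ L` (`compL`, semantics `eval_compL`) is one parity of 4-fold ANDs of code bits, so a
table-level `AC⁰[⊕]` signer of the solo slice (`FlatDial.signers`, g11 `T ⟺ T_tab`) composed with the reading/composition layer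
(`redTab`, `acRealOver_redTab`, `strFunC`, `acRealOver_strFunC`) separates the index-2 slice (`nilSlice_two_mem_of_signer`).  Hence
`rungANonuniform_of_nilRung_two`, ★ `nilRung_two_iff : NilRung (fun _ => 2) ↔ AnfPresentation.RungANonuniform`, `constNilRung_one_iff`,
`dial_summary_rev3`.
-/

set_option linter.dupNamespace false

noncomputable section

namespace Summit.QuantumAdvantage.QuantumAdvantage.Theorems.CouplingDial

open Finset
open Literature.Computability.Complexity
open Literature.Computability.QuantumComplexity
open Literature.Computability.MetaComplexity
open _root_.Computability (encodeNat)
open Summit.QuantumAdvantage.QuantumAdvantage.Theorems.HintDial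
open Summit.QuantumAdvantage.QuantumAdvantage.Theorems.HintDial.Automaton
open Summit.QuantumAdvantage.QuantumAdvantage.Theorems.GapDial.Automaton (blockDiag blockDiag_left blockDiag_right
  mv_blockDiag bd_zero_left EE bxor_append)
open Summit.QuantumAdvantage.QuantumAdvantage.Theorems.FlatDial (clen length_encode_eq_clen clen_injective clen_lt_clen le_clen)
open Summit.QuantumAdvantage.QuantumAdvantage.Theses.AnfPresentation (RungANonuniform RungA LiftA AnfEquiv NearExactIsExact
  SignedExactSliceIsLift)
open CubicForm (bit)
open DerivativeWalsh (W)
open BuzetChailloux (bxor zeroVec)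

/-! ## §11 ★★ `N_2 ⟺ T`: INDEX-2 COUPLINGS ARE FREE (critic row 71v14: «certify `ConstNilRung c ⟺ T` for constant `c`» — done for `c = 1`)

An index-2 unipotent coupling is an INVOLUTION (`(𝟙 ⊕ N)² = 𝟙 ⊕ N² = 𝟙` over `𝔽₂`), so `L⁻¹ = L` and the substitution `y ↦ L y`
rewrites `Φ_L(F, G) = Φ_𝟙(F, G ∘ L)` (`value_compL_of_involutive`).  The cubic table of `G ∘ L` has entries
`Σ_{ijl} G_{ijl} L_{ia} L_{jb} L_{lc}` (`compL`, `eval_compL`) — ONE parity of 4-fold ANDs of instance bits, two `AC⁰[⊕]` layers on top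
of the literal reading of the code (`acRealOver_redTab`).  Composing a TABLE-LEVEL SIGNER of the solo slice (g11: `T ⟺ T_tab`,
`FlatDial.signedSlice_not_mem_promiseLift_iff_no_signer`) with this layer gives a string-level `AC⁰[⊕]` separator of the index-2 slice
(`nilSlice_two_mem_of_signer`): `¬T ⟹ ¬N_2`.  Hence ★ `nilRung_two_iff : N_2 ⟺ T`, `constNilRung_one_iff`, and the ladder reads
`T ⟺ N_1 ⟺ N_2 ⟹ N_{c+1} ⟹ W′ = N_{log n+1} ⟹ … ⟹ N_{n/6}` (THEOREM).  [For `c ≥ 2`, `L⁻¹ = 𝟙 ⊕ N ⊕ … ⊕ N^c` needs the iterated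
products `N^j`, each one more parity-of-ANDs layer: the same proof shape, not typed here.] -/

section IndexTwo

open Summit.QuantumAdvantage.QuantumAdvantage.Theorems.FlatDial (tabN tabEquiv formOf pairOf tabOf pairOf_tabOf realisable signers
  rd pos pol ext rd_ext_encode pos_lt_clen tabN_le_clen tabN_eq acRealOver_parity acRealOver_and2 bit_parity
  signedSlice_not_mem_promiseLift_iff_no_signer length_encode_pairOf)

variable {n : ℕ}

/-! ### 11a The composed table `G ∘ L` -/

/-- number of cube positions (`= n³`). -/
def triN (n : ℕ) : ℕ := Fintype.card (Fin n × Fin n × Fin n)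

/-- a fixed enumeration of the cube positions. -/
def triEquiv (n : ℕ) : (Fin n × Fin n × Fin n) ≃ Fin (triN n) := Fintype.equivFin _

/-- CouplingDialConst helper `triN_eq` (decomp-qadv land package; see the module docstring). -/
theorem triN_eq (n : ℕ) : triN n = n ^ 3 := by
  simp [triN, Fintype.card_prod]; ring

/-- the summand `G_q · L_{q₁ a} · L_{q₂ b} · L_{q₃ c}` of a composed coefficient. -/
def compTerm (Gc : Fin n → Fin n → Fin n → Bool) (L : Fin n → Fin n → Bool) (a b c : Fin n) (q : Fin n × Fin n × Fin n) : Bool :=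
  ((Gc q.1 q.2.1 q.2.2 && L q.1 a) && L q.2.1 b) && L q.2.2 c

/-- the composed coefficient at `(a,b,c)`: ONE parity of the `n³` summands. -/
def compAt (Gc : Fin n → Fin n → Fin n → Bool) (L : Fin n → Fin n → Bool) (a b c : Fin n) : Bool :=
  decide (Odd (GateFn.numOnes fun m : Fin (triN n) => compTerm Gc L a b c ((triEquiv n).symm m)))

/-- ★ THE CUBIC TABLE OF `y ↦ G(L y)`. -/
def compL (G : CubicForm n) (L : Fin n → Fin n → Bool) : CubicForm n := ⟨G.const, compAt G.cube L⟩

/-- CouplingDialConst helper `sum_triple` (decomp-qadv land package; see the module docstring). -/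
theorem sum_triple {R : Type*} [AddCommMonoid R] (f : Fin n → Fin n → Fin n → R) :
    ∑ i, ∑ j, ∑ l, f i j l = ∑ q : Fin n × Fin n × Fin n, f q.1 q.2.1 q.2.2 := by
  simp only [Fintype.sum_prod_type]

/-- CouplingDialConst helper `prod3_sum` (decomp-qadv land package; see the module docstring). -/
theorem prod3_sum {R : Type*} [CommSemiring R] (A B C : Fin n → R) :
    (∑ a, A a) * (∑ b, B b) * (∑ c, C c) = ∑ a, ∑ b, ∑ c, A a * B b * C c := by
  rw [Finset.sum_mul_sum, Finset.sum_mul]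
  refine sum_congr rfl fun a _ => ?_
  rw [Finset.sum_mul]
  refine sum_congr rfl fun b _ => ?_
  rw [Finset.mul_sum]

/-- CouplingDialConst helper `bit_compAt` (decomp-qadv land package; see the module docstring). -/
theorem bit_compAt (Gc : Fin n → Fin n → Fin n → Bool) (L : Fin n → Fin n → Bool) (a b c : Fin n) :
    bit (compAt Gc L a b c) = ∑ i, ∑ j, ∑ l, bit (Gc i j l) * (bit (L i a) * bit (L j b) * bit (L l c)) := by
  rw [compAt, bit_parity, Equiv.sum_comp (triEquiv n).symm (fun q => bit (compTerm Gc L a b c q)), sum_triple]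
  refine sum_congr rfl fun q _ => ?_
  simp only [compTerm, bit_and]
  ring

/-- CouplingDialConst helper `bit_mv` (decomp-qadv land package; see the module docstring). -/
theorem bit_mv (L : Fin n → Fin n → Bool) (y : Fin n → Bool) (i : Fin n) : bit (mv L y i) = ∑ a, bit (L i a) * bit (y a) :=
  bit_bd _ _

/-- ★ SEMANTICS: `(compL G L)(y) = G(L y)`. -/
theorem eval_compL (G : CubicForm n) (L : Fin n → Fin n → Bool) (y : Fin n → Bool) : (compL G L).eval y = G.eval (mv L y) := by
  apply bit_injective
  rw [eval_bit, eval_bit, show (compL G L).const = G.const from rfl]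
  congr 1
  show ∑ a, ∑ b, ∑ c, bit (compAt G.cube L a b c) * (bit (y a) * bit (y b) * bit (y c)) = _
  simp_rw [bit_compAt, bit_mv, prod3_sum, Finset.sum_mul, Finset.mul_sum, sum_triple]
  rw [Finset.sum_comm]
  exact sum_congr rfl fun q _ => sum_congr rfl fun r _ => by ring

/-! ### 11b Index two ⟹ involution ⟹ the value is a solo value -/

/-- an index-2 unipotent matrix is an involution: `L (L y) = y`. -/
theorem mv_mv_of_unipotent_two {k : ℕ} {L : Fin k → Fin k → Bool} (h : Unipotent L 2) (y : Fin k → Bool) : mv L (mv L y) = y := by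
  have h2 : bxor (mv L (bxor (mv L y) y)) (bxor (mv L y) y) = zeroVec := h y
  rw [mv_bxor] at h2
  funext i
  have hi : ((mv L (mv L y) i ^^ mv L y i) ^^ (mv L y i ^^ y i)) = false := congr_fun h2 i
  revert hi
  generalize mv L (mv L y) i = p
  generalize mv L y i = q
  generalize y i = r
  cases p <;> cases q <;> cases r <;> decide

/-- ★ `Φ_𝟙(F, G ∘ L) = Φ_L(F, G)` for an involution `L` (substitute `y ↦ L y`). -/
theorem value_compL_of_involutive (I : CTriple) (hL : ∀ y, mv I.L (mv I.L y) = y) :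
    (⟨I.n, I.F, compL I.G I.L⟩ : CubicANFPair).value = I.cvalue := by
  unfold CTriple.cvalue CubicANFPair.value forrelation
  congr 1
  refine sum_congr rfl fun x _ => ?_
  simp_rw [eval_compL]
  exact Fintype.sum_bijective (mv I.L) (Function.Involutive.bijective hL) _ _ fun y => by rw [hL]

/-! ### 11c Reading a coupled code: matrix bits at even prefix positions, tables through `FlatDial.rd` -/

/-- offset of the pair code inside a coupled code. -/
def off (n : ℕ) : ℕ := 2 * (n * n) + 2

/-- CouplingDialConst helper `getD_boolPair_two_mul` (decomp-qadv land package; see the module docstring). -/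
theorem getD_boolPair_two_mul (x y : List Bool) {q : ℕ} (hq : q < x.length) : (boolPair x y).getD (2 * q) false = x.getD q false := by
  induction x generalizing q with
  | nil => simp at hq
  | cons b x ih =>
    cases q with
    | zero => simp [boolPair]
    | succ q =>
      rw [show 2 * (q + 1) = 2 * q + 1 + 1 by ring, show boolPair (b :: x) y = b :: b :: boolPair x y by simp [boolPair],
        List.getD_cons_succ, List.getD_cons_succ, List.getD_cons_succ]
      exact ih (by simpa using hq)

/-- CouplingDialConst helper `getD_boolPair_shift` (decomp-qadv land package; see the module docstring). -/
theorem getD_boolPair_shift (x y : List Bool) (i : ℕ) : (boolPair x y).getD (2 * x.length + 2 + i) false = y.getD i false := by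
  rw [List.getD_eq_getElem?_getD, List.getD_eq_getElem?_getD, ← List.getElem?_drop, drop_boolPair]

/-- CouplingDialConst helper `ext_get` (decomp-qadv land package; see the module docstring). -/
theorem ext_get (l : List Bool) (i : ℕ) : ext l.get i = l.getD i false := by
  unfold Theorems.FlatDial.ext
  split
  · next h => simp [List.getD_eq_getElem?_getD, List.getElem?_eq_getElem h]
  · next h => simp [List.getD_eq_getElem?_getD, List.getElem?_eq_none (not_lt.mp h)]

/-- the matrix entry `L a b` is the code symbol at position `2·⟨a,b⟩`. -/
theorem ext_encode_mat (I : CTriple) (a b : Fin I.n) :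
    ext I.encode.get (2 * ((finProdFinEquiv (a, b) : Fin (I.n * I.n)) : ℕ)) = I.L a b := by
  have hq : ((finProdFinEquiv (a, b) : Fin (I.n * I.n)) : ℕ) < I.n * I.n := Fin.isLt _
  rw [ext_get, CTriple.encode, getD_boolPair_two_mul _ _ (by rw [length_matBits]; exact hq), CTriple.matBits,
    List.getD_eq_getElem?_getD]
  simp only [List.getElem?_ofFn, dif_pos hq, Option.getD_some, Fin.eta, Equiv.symm_apply_apply]

/-- the table bits are read through the g11 reader, shifted by the matrix prefix. -/
theorem rd_encode (I : CTriple) : rd I.n (fun i => ext I.encode.get (off I.n + i)) = tabOf ⟨I.n, I.F, I.G⟩ := by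
  have hfun : (fun i => ext I.encode.get (off I.n + i)) = ext I.pair.encode.get := by
    funext i
    rw [ext_get, ext_get, CTriple.encode, off, show 2 * (I.n * I.n) + 2 = 2 * (CTriple.matBits I.L).length + 2 by
      rw [length_matBits], getD_boolPair_shift]
  rw [hfun]
  have h := rd_ext_encode I.pair.n (tabOf I.pair)
  rw [pairOf_tabOf] at h
  exact h

/-! ### 11d The reduced table vector and the string-level separator -/

/-- ★ THE REDUCTION ON TABLES: keep `F` and the constant of `G`, replace the cube of `G` by the cube of `G ∘ L`. -/
def redTab (n : ℕ) (L : Fin n → Fin n → Bool) (t : Fin (tabN n) → Bool) : Fin (tabN n) → Bool := fun k =>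
  match (tabEquiv n).symm k with
  | (true, some (a, b, c)) => compAt (fun i j l => t (tabEquiv n (true, some (i, j, l)))) L a b c
  | _ => t k

/-- CouplingDialConst helper `redTab_tabOf` (decomp-qadv land package; see the module docstring). -/
theorem redTab_tabOf (n : ℕ) (F G : CubicForm n) (L : Fin n → Fin n → Bool) :
    redTab n L (tabOf ⟨n, F, G⟩) = tabOf ⟨n, F, compL G L⟩ := by
  funext k
  obtain ⟨⟨b, o⟩, rfl⟩ := (tabEquiv n).surjective k
  cases b with
  | false => rcases o with _ | ⟨a, b', c⟩ <;> simp [redTab, tabOf, Equiv.symm_apply_apply, compL]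
  | true =>
    rcases o with _ | ⟨a, b', c⟩
    · simp [redTab, tabOf, Equiv.symm_apply_apply, compL]
    · simp only [redTab, tabOf, Equiv.symm_apply_apply, compL]

open Classical in
/-- ★ THE STRING-LEVEL FAMILY induced by a table-level family `D` of the SOLO alphabet: on a coupled code of length `tlen n`, read
`L` and the tables, form the tables of `(F, G ∘ L)` and apply `D n`; reject other lengths. -/
def strFunC (D : (n : ℕ) → (Fin (tabN n) → Bool) → Bool) (N : ℕ) (y : Fin N → Bool) : Bool :=
  if h : ∃ n, tlen n = N then
    D (Classical.choose h) (redTab (Classical.choose h)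
      (fun a b => ext y (2 * ((finProdFinEquiv (a, b) : Fin (Classical.choose h * Classical.choose h)) : ℕ)))
      (rd (Classical.choose h) fun i => ext y (off (Classical.choose h) + i)))
  else false

/-- ★ On a coupled code the string family answers what `D` answers on the tables of `(F, G ∘ L)`. -/
theorem strFunC_encode (D : (n : ℕ) → (Fin (tabN n) → Bool) → Bool) (I : CTriple) :
    strFunC D I.encode.length I.encode.get = D I.n (tabOf ⟨I.n, I.F, compL I.G I.L⟩) := by
  have h : ∃ n, tlen n = I.encode.length := ⟨I.n, (length_encode I).symm⟩
  rw [strFunC, dif_pos h]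
  have hn : Classical.choose h = I.n := tlen_injective ((Classical.choose_spec h).trans (length_encode I))
  rw [hn]
  have hL : (fun a b => ext I.encode.get (2 * ((finProdFinEquiv (a, b) : Fin (I.n * I.n)) : ℕ))) = I.L :=
    funext fun a => funext fun b => ext_encode_mat I a b
  rw [hL, rd_encode, redTab_tabOf]

/-- realisation of every coordinate of the reduced table vector as a function of the CODE: depth `5`, size `15 n³ + 1`. -/
theorem acRealOver_redTab {n N : ℕ} (hoff : ∀ k : Fin (tabN n), off n + pos n k < N)
    (hmat : ∀ a b : Fin n, 2 * ((finProdFinEquiv (a, b) : Fin (n * n)) : ℕ) < N) (k : Fin (tabN n)) :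
    ACRealOver (accBasis 2) (fun y : Fin N → Bool =>
      redTab n (fun a b => ext y (2 * ((finProdFinEquiv (a, b) : Fin (n * n)) : ℕ))) (rd n fun i => ext y (off n + i)) k)
      5 (triN n * 15 + 1) := by
  have hT : ∀ k' : Fin (tabN n), ACRealOver (accBasis 2) (fun y : Fin N → Bool => rd n (fun i => ext y (off n + i)) k') 1 1 :=
    fun k' => (acRealOver_evalLit 2 (Sum.inr (pol n k', ⟨off n + pos n k', hoff k'⟩) : Lit N)).congr fun y => by
      show xor (pol n k') (y ⟨off n + pos n k', hoff k'⟩) = xor (pol n k') (ext y (off n + pos n k'))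
      rw [Theorems.FlatDial.ext, dif_pos (hoff k')]
  have hL : ∀ a b : Fin n, ACRealOver (accBasis 2)
      (fun y : Fin N → Bool => ext y (2 * ((finProdFinEquiv (a, b) : Fin (n * n)) : ℕ))) 1 1 := fun a b =>
    ((acRealOver_input (accBasis 2) (⟨_, hmat a b⟩ : Fin N)).mono zero_le_one zero_le_one).congr fun y => by
      show y ⟨_, hmat a b⟩ = ext y _
      rw [Theorems.FlatDial.ext, dif_pos (hmat a b)]
  have h15 : 1 ≤ triN n * 15 + 1 := Nat.le_add_left 1 _
  obtain ⟨⟨b, o⟩, rfl⟩ := (tabEquiv n).surjective k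
  cases b with
  | false =>
    rcases o with _ | ⟨a, b', c⟩
    · exact ((hT (tabEquiv n (false, none))).mono (by norm_num) h15).congr fun y => by
        simp only [redTab, Equiv.symm_apply_apply]
    · exact ((hT (tabEquiv n (false, some (a, b', c)))).mono (by norm_num) h15).congr fun y => by
        simp only [redTab, Equiv.symm_apply_apply]
  | true =>
    rcases o with _ | ⟨a, b', c⟩
    · exact ((hT (tabEquiv n (true, none))).mono (by norm_num) h15).congr fun y => by
        simp only [redTab, Equiv.symm_apply_apply]
    · have hterm : ∀ m : Fin (triN n), ACRealOver (accBasis 2) (fun y : Fin N → Bool =>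
          compTerm (fun i j l => rd n (fun i' => ext y (off n + i')) (tabEquiv n (true, some (i, j, l))))
            (fun a b => ext y (2 * ((finProdFinEquiv (a, b) : Fin (n * n)) : ℕ))) a b' c ((triEquiv n).symm m)) 4 15 := fun m =>
        (acRealOver_and2 (acRealOver_and2 (acRealOver_and2 (hT _) (hL _ _)) ((hL _ _).mono (by norm_num) (by norm_num)))
          ((hL _ _).mono (by norm_num) (by norm_num))).congr fun y => rfl
      exact (acRealOver_parity hterm).congr fun y => by simp only [redTab, Equiv.symm_apply_apply, compAt]

/-- the size polynomial of the string family. -/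
def cPoly (r : Polynomial ℕ) : Polynomial ℕ := r + 2 * (Polynomial.X ^ 3 + 1) * (15 * Polynomial.X ^ 3 + 1)

/-- CouplingDialConst helper `cPoly_eval` (decomp-qadv land package; see the module docstring). -/
theorem cPoly_eval (r : Polynomial ℕ) (N : ℕ) : (cPoly r).eval N = r.eval N + 2 * (N ^ 3 + 1) * (15 * N ^ 3 + 1) := by
  simp [cPoly]

/-- ★ The string family is `AC⁰[⊕]`: depth `d + 5`, size `cPoly r` (`D n` composed with the reading/composition layer: `ACRealOver.comp`). -/
theorem acRealOver_strFunC {D : (n : ℕ) → (Fin (tabN n) → Bool) → Bool} {d : ℕ} {r : Polynomial ℕ}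
    (hD : ∀ n, ACRealOver (accBasis 2) (D n) d (r.eval n)) (N : ℕ) :
    ACRealOver (accBasis 2) (strFunC D N) (d + 5) ((cPoly r).eval N) := by
  rw [cPoly_eval]
  by_cases h : ∃ n, tlen n = N
  · have hN : tlen (Classical.choose h) = N := Classical.choose_spec h
    set n := Classical.choose h with hn
    have hnN : n ≤ N := (le_clen n).trans (by rw [← hN]; unfold tlen; omega)
    have hoff : ∀ k : Fin (tabN n), off n + pos n k < N := fun k => by
      have := pos_lt_clen n k; rw [← hN]; unfold tlen off; omega
    have hmat : ∀ a b : Fin n, 2 * ((finProdFinEquiv (a, b) : Fin (n * n)) : ℕ) < N := fun a b => by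
      have := (finProdFinEquiv (a, b) : Fin (n * n)).isLt; rw [← hN]; unfold tlen; omega
    have hc := (hD n).comp fun k => acRealOver_redTab hoff hmat k
    refine (hc.mono le_rfl ?_).congr fun y => ?_
    · rw [sum_const, card_univ, Fintype.card_fin, smul_eq_mul, tabN_eq, triN_eq]
      have h3 : n ^ 3 ≤ N ^ 3 := Nat.pow_le_pow_left hnN 3
      exact Nat.add_le_add (natPoly_eval_mono r hnN) (Nat.mul_le_mul (by omega) (by omega))
    · rw [strFunC, dif_pos h]
  · refine ((acRealOver_const (acBasis_subset_accBasis 2) false).mono (by omega) ?_).congr fun y => ?_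
    · have h0 : 0 < 2 * (N ^ 3 + 1) * (15 * N ^ 3 + 1) := by positivity
      exact le_add_left (Nat.succ_le_of_lt h0)
    · rw [strFunC, dif_neg h]

/-- ★★ A TABLE-LEVEL SIGNER OF THE SOLO SLICE PUTS THE INDEX-2 SLICE IN promise-`AC⁰[⊕]`. -/
theorem nilSlice_two_mem_of_signer {D : (n : ℕ) → (Fin (tabN n) → Bool) → Bool} (hr : D ∈ realisable) (hs : D ∈ signers) :
    NilSlice (fun _ => 2) ∈ promiseLift (AC0Mod 2) := by
  obtain ⟨d, r, hD⟩ := hr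
  choose C hC using fun N => (acRealOver_strFunC hD N).toCircuit
  have key : ∀ I : CTriple, (pairOf I.n (tabOf ⟨I.n, I.F, compL I.G I.L⟩)).value = I.cvalue →
      strFunC D I.encode.length I.encode.get = D I.n (tabOf ⟨I.n, I.F, compL I.G I.L⟩) := fun I _ => strFunC_encode D I
  have hval : ∀ I : CTriple, Unipotent I.L 2 → (pairOf I.n (tabOf ⟨I.n, I.F, compL I.G I.L⟩)).value = I.cvalue := fun I hu => by
    rw [pairOf_tabOf ⟨I.n, I.F, compL I.G I.L⟩]; exact value_compL_of_involutive I (mv_mv_of_unipotent_two hu)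
  refine ⟨{x | strFunC D x.length x.get = true}, ⟨d + 5, cPoly r, C,
    fun N => ⟨(hC N).1, (hC N).2.1, (hC N).2.2.1⟩, fun x => ?_⟩, ?_, ?_⟩
  · rw [(hC x.length).2.2.2 x.get]
    cases hx : strFunC D x.length x.get
    · symm; exact (Set.notMem_iff_boolIndicator _ _).1 (by simp [hx])
    · symm; exact (Set.mem_iff_boolIndicator _ _).1 (by simpa using hx)
  · rintro x ⟨I, ⟨hev, hu, hv⟩, rfl⟩
    show strFunC D I.encode.length I.encode.get = true
    rw [key I (hval I hu)]
    exact (hs I.n _ hev).1 ((hval I hu).trans hv)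
  · rintro x ⟨I, ⟨hev, hu, hv⟩, rfl⟩
    show ¬ strFunC D I.encode.length I.encode.get = true
    rw [key I (hval I hu), (hs I.n _ hev).2 ((hval I hu).trans hv)]
    exact Bool.false_ne_true

/-- ★★ `N_2 ⟹ T`: hardness of the index-2 slice already gives item 27991 (a solo signer would sign the index-2 slice). -/
theorem rungANonuniform_of_nilRung_two : NilRung (fun _ => 2) → RungANonuniform := by
  intro h2
  by_contra hT
  have hex : ∃ D : (n : ℕ) → (Fin (tabN n) → Bool) → Bool, D ∈ realisable ∧ D ∈ signers := by
    by_contra hne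
    exact hT (signedSlice_not_mem_promiseLift_iff_no_signer.mpr hne)
  obtain ⟨D, hr, hs⟩ := hex
  exact h2 (nilSlice_two_mem_of_signer hr hs)

/-- ★★★ `N_2 ⟺ T` IN KERNEL: the first notch of the unipotency dial above the identity is STILL item 27991. -/
theorem nilRung_two_iff : NilRung (fun _ => 2) ↔ RungANonuniform :=
  ⟨rungANonuniform_of_nilRung_two, nilRung_of_rungANonuniform fun _ => one_le_two⟩

/-- `ConstNilRung 1 ⟺ T`. -/
theorem constNilRung_one_iff : ConstNilRung 1 ↔ RungANonuniform := nilRung_two_iff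

/-- the ladder after rev 3: `T ⟺ N_1 ⟺ N_2 ⟹ W′ = N_{log n+1} ⟹ N_{n/6}` (last a THEOREM). -/
theorem dial_summary_rev3 :
    (RungANonuniform ↔ NilRung fun _ => 1) ∧ (RungANonuniform ↔ NilRung fun _ => 2) ∧ (RungANonuniform → LogNilRung) ∧
    NilRung (fun n => n / 6) :=
  ⟨rungANonuniform_iff_nilRung_one, nilRung_two_iff.symm, logNilRung_of_rungANonuniform, nilRung_sixth⟩

end IndexTwo

end Summit.QuantumAdvantage.QuantumAdvantage.Theorems.CouplingDial

end
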